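import Mathlib
import Summits.Ventures.PercRepro2.HCov
import Summits.Ventures.PercRepro2.OneEdge
import Summits.Ventures.PercRepro2.CCTRootEdge
import Summits.Ventures.PercRepro2.HCovPlusQuartic

/-!
# THE `o`-EDGE GLUING DICTIONARY: the open pin of an `o`-edge in the masses of the closed pin
(blind cell PercRepro2, p5 g17; `proofs/P5-OEDGE.md` §23)

At an `o`-edge `e = {a₃, o}` the open pin glues `o` to `a₃`. With `ω′ = ω[e↦closed]`
(`OneEdge.conn_update_true_iff`): `ω[e↦open] ∈ Q ↔ ω′ ∈ Q ∧ ¬(a₁ ↔ a₃ ∧ a₂ ↔ o) ∧ ¬(a₂ ↔ a₃ ∧ a₁ ↔ o)`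
(**`update_true_mem_Q_iff_oedge`** — `Q` survives iff `a₃` and `o` are not on opposite sides), and
`a₃ ∈ U` at the open pin iff `a₃ ∈ U ∨ o ∈ U` at the closed one. Hence, in the masses of `p[e↦0]`:
**`Q₁ = P₀(Q ∩ Nopp)`** (`prob_one_Q_oedge`), **`D₁ = P₀(PD ∩ {o ∉ U}) = D₀ − Do₀`**
(`prob_one_PD_oedge`, `prob_one_PD_oedge'`), `Do₁ = 0` (`HCovPlusQuartic.Do_one_oedge`),
**`Qo₁ = P₀(Q ∩ Nopp ∩ ({o ∈ U} ∪ {a₃ ∈ U}))`** (`Qo_one_oedge`), and the quartic's cross term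
**`covUm_oedge_decomp`**: `covUm = Qo₁·D₀ + Qo₀·(D₀ − Do₀) − Q₁·Do₀`. The `o`-edge face of the
quartic road (`0 ≤ H1, H2, H3` there, with `H₄ = Qo₁·D₁·slackB₁ ≥ 0` the open pin) is thereby a
statement in the closed pin's vocabulary; no sign is claimed.
-/

namespace Summit.Ventures.PercRepro2

open UnionCluster CovForm CCT HCovPlusQuartic

namespace QuarticOEdgeGlue

section Glue

variable {V : Type*} {E : Type*} [Fintype V] [DecidableEq V] [Fintype E] [DecidableEq E]
  {R : Type*} [Field R] [LinearOrder R] [IsStrictOrderedRing R]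

variable {ends : E → Sym2 V} {e : E} {o a₃ : V}

/-- `a₃` and `o` not on opposite sides: `¬(a₁ ↔ a₃ ∧ a₂ ↔ o) ∧ ¬(a₂ ↔ a₃ ∧ a₁ ↔ o)`. -/
def Nopp (ends : E → Sym2 V) (o a₁ a₂ a₃ : V) : Set (Config E) :=
  (connEvent ends a₁ a₃ ∩ connEvent ends a₂ o)ᶜ ∩ (connEvent ends a₂ a₃ ∩ connEvent ends a₁ o)ᶜ

omit [Fintype V] [DecidableEq V] [Fintype E] [LinearOrder R] [IsStrictOrderedRing R] in
/-- Connections through the opened `o`-edge: `x ↔ y` in `ω[e↦open]` iff `x ↔ y`, or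
`x ↔ a₃ ∧ o ↔ y`, or `x ↔ o ∧ a₃ ↔ y` in `ω[e↦closed]`. -/
lemma conn_update_true_oedge_iff (hends : ends e = s(a₃, o)) (ω : Config E) (x y : V) :
    Conn ends (Function.update ω e true) x y ↔
      Conn ends (Function.update ω e false) x y ∨
        (Conn ends (Function.update ω e false) x a₃ ∧ Conn ends (Function.update ω e false) o y) ∨
        (Conn ends (Function.update ω e false) x o ∧ Conn ends (Function.update ω e false) a₃ y) := by
  have h := OneEdge.conn_update_true_iff hends (Function.update ω e false) x y
  rw [Function.update_idem] at h
  exact h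

omit [Fintype V] [DecidableEq V] [Fintype E] [LinearOrder R] [IsStrictOrderedRing R] in
/-- **`Q` at the open pin of an `o`-edge**: `ω[e↦open] ∈ Q ↔ ω[e↦closed] ∈ Q ∩ Nopp`. -/
lemma update_true_mem_Q_iff_oedge (hends : ends e = s(a₃, o)) (a₁ a₂ : V) (ω : Config E) :
    Function.update ω e true ∈ avoidAll ends a₂ {a₁} ↔
      Function.update ω e false ∈ avoidAll ends a₂ {a₁} ∩ Nopp ends o a₁ a₂ a₃ := by
  simp only [mem_avoidAll, Finset.mem_singleton, forall_eq, Nopp, Set.mem_inter_iff,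
    Set.mem_compl_iff, mem_connEvent, conn_update_true_oedge_iff hends ω a₂ a₁]
  constructor
  · intro h
    refine ⟨fun h21 => h (Or.inl h21), fun ⟨h13, h2o⟩ => h (Or.inr (Or.inr ⟨h2o, conn_symm h13⟩)),
      fun ⟨h23, h1o⟩ => h (Or.inr (Or.inl ⟨h23, conn_symm h1o⟩))⟩
  · rintro ⟨h21, hA, hB⟩ (h | ⟨h23, ho1⟩ | ⟨h2o, h31⟩)
    · exact h21 h
    · exact hB ⟨h23, conn_symm ho1⟩
    · exact hA ⟨conn_symm h31, h2o⟩

omit [Fintype V] [DecidableEq V] [LinearOrder R] [IsStrictOrderedRing R] in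
/-- **`Q₁ = P₀(Q ∩ Nopp)`** at an `o`-edge. -/
theorem prob_one_Q_oedge (p : E → R) (hends : ends e = s(a₃, o)) (a₁ a₂ : V) :
    prob (Function.update p e 1) (avoidAll ends a₂ {a₁}) =
      prob (Function.update p e 0) (avoidAll ends a₂ {a₁} ∩ Nopp ends o a₁ a₂ a₃) := by
  rw [prob_update_one_eq, prob_update_zero_eq]
  congr 1
  ext ω
  simp only [Set.mem_setOf_eq, update_true_mem_Q_iff_oedge hends a₁ a₂ ω]

omit [Fintype V] [DecidableEq V] [Fintype E] [LinearOrder R] [IsStrictOrderedRing R] in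
/-- `a₃ ∈ U` at the open pin iff `a₃ ∈ U ∨ o ∈ U` at the closed one. -/
lemma update_true_mem_inU_iff_oedge (hends : ends e = s(a₃, o)) (a₁ a₂ : V) (ω : Config E) :
    Function.update ω e true ∈ inU ends a₁ a₂ a₃ ↔
      Function.update ω e false ∈ inU ends a₁ a₂ a₃ ∪ inU ends a₁ a₂ o := by
  simp only [mem_inU, Set.mem_union, conn_update_true_oedge_iff hends ω a₃ a₁,
    conn_update_true_oedge_iff hends ω a₃ a₂]
  have hr : Conn ends (Function.update ω e false) a₃ a₃ := conn_refl ends _ a₃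
  constructor
  · rintro ((h | ⟨_, ho1⟩ | ⟨h3o, h31⟩) | (h | ⟨_, ho2⟩ | ⟨h3o, h32⟩))
    · exact Or.inl (Or.inl h)
    · exact Or.inr (Or.inl ho1)
    · exact Or.inl (Or.inl h31)
    · exact Or.inl (Or.inr h)
    · exact Or.inr (Or.inr ho2)
    · exact Or.inl (Or.inr h32)
  · rintro ((h | h) | (h | h))
    · exact Or.inl (Or.inl h)
    · exact Or.inr (Or.inl h)
    · exact Or.inl (Or.inr (Or.inl ⟨hr, h⟩))
    · exact Or.inr (Or.inr (Or.inl ⟨hr, h⟩))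

omit [Fintype V] [DecidableEq V] [LinearOrder R] [IsStrictOrderedRing R] in
/-- **`D₁ = P₀(PD ∩ {o ∉ U})`** at an `o`-edge (on `PD ∩ {o ∉ U}` the `Nopp` condition is automatic). -/
theorem prob_one_PD_oedge (p : E → R) (hends : ends e = s(a₃, o)) (a₁ a₂ : V) :
    prob (Function.update p e 1) (PDEvent ends a₁ a₂ a₃) =
      prob (Function.update p e 0) (PDEvent ends a₁ a₂ a₃ ∩ (inU ends a₁ a₂ o)ᶜ) := by
  rw [prob_update_one_eq, prob_update_zero_eq]
  congr 1
  ext ω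
  simp only [Set.mem_setOf_eq, PDEvent, Dtilde, Set.mem_inter_iff, Set.mem_compl_iff, mem_inU,
    mem_connEvent, conn_update_true_oedge_iff hends ω a₁ a₂, conn_update_true_oedge_iff hends ω a₃ a₁,
    conn_update_true_oedge_iff hends ω a₃ a₂]
  have r3 : Conn ends (Function.update ω e false) a₃ a₃ := conn_refl ends _ a₃
  constructor
  · rintro ⟨hQ, h3⟩
    exact ⟨⟨fun h => hQ (Or.inl h), fun h => h3 (h.elim (fun h31 => Or.inl (Or.inl h31))
      (fun h32 => Or.inr (Or.inl h32)))⟩,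
      fun h => h3 (h.elim (fun ho1 => Or.inl (Or.inr (Or.inl ⟨r3, ho1⟩)))
        (fun ho2 => Or.inr (Or.inr (Or.inl ⟨r3, ho2⟩))))⟩
  · rintro ⟨⟨h12, h3⟩, ho⟩
    refine ⟨fun h => ?_, fun h => ?_⟩
    · rcases h with h | ⟨_, ho2⟩ | ⟨_, h32⟩
      · exact h12 h
      · exact ho (Or.inr ho2)
      · exact h3 (Or.inr h32)
    · rcases h with (h31 | ⟨_, ho1⟩ | ⟨_, h31⟩) | (h32 | ⟨_, ho2⟩ | ⟨_, h32⟩)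
      · exact h3 (Or.inl h31)
      · exact ho (Or.inl ho1)
      · exact h3 (Or.inl h31)
      · exact h3 (Or.inr h32)
      · exact ho (Or.inr ho2)
      · exact h3 (Or.inr h32)

omit [Fintype V] [DecidableEq V] in
/-- **`D₁ = D₀ − Do₀`** at an `o`-edge. -/
theorem prob_one_PD_oedge' (p : E → R) (hends : ends e = s(a₃, o)) (a₁ a₂ : V) :
    prob (Function.update p e 1) (PDEvent ends a₁ a₂ a₃) =
      prob (Function.update p e 0) (PDEvent ends a₁ a₂ a₃) -
        Do (Function.update p e 0) ends o a₁ a₂ a₃ := by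
  rw [prob_one_PD_oedge p hends a₁ a₂]
  have hsplit := prob_inter_add_prob_inter_compl (Function.update p e 0) (PDEvent ends a₁ a₂ a₃)
    (inU ends a₁ a₂ o)
  have hDo : prob (Function.update p e 0) (PDEvent ends a₁ a₂ a₃ ∩ inU ends a₁ a₂ o) =
      Do (Function.update p e 0) ends o a₁ a₂ a₃ := by
    unfold Do
    have hdisj : Disjoint (PDEvent ends a₁ a₂ a₃ ∩ connEvent ends a₁ o)
        (PDEvent ends a₁ a₂ a₃ ∩ connEvent ends a₂ o) := by
      rw [Set.disjoint_left]
      rintro ω ⟨hPD, h1o⟩ ⟨_, h2o⟩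
      simp only [PDEvent, Dtilde, Set.mem_inter_iff, Set.mem_compl_iff, mem_connEvent] at hPD
      exact hPD.1 (conn_trans h1o (conn_symm h2o))
    rw [← prob_union_of_disjoint _ hdisj]
    congr 1
    ext ω
    simp only [Set.mem_inter_iff, mem_inU, mem_connEvent, Set.mem_union]
    constructor
    · rintro ⟨hPD, ho1 | ho2⟩
      · exact Or.inl ⟨hPD, conn_symm ho1⟩
      · exact Or.inr ⟨hPD, conn_symm ho2⟩
    · rintro (⟨hPD, h1o⟩ | ⟨hPD, h2o⟩)
      · exact ⟨hPD, Or.inl (conn_symm h1o)⟩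
      · exact ⟨hPD, Or.inr (conn_symm h2o)⟩
  linarith [hsplit, hDo]

omit [Fintype V] [DecidableEq V] [LinearOrder R] [IsStrictOrderedRing R] in
/-- **`Qo₁ = P₀(Q ∩ Nopp ∩ ({o ∈ U} ∪ {a₃ ∈ U}))`** at an `o`-edge. -/
theorem Qo_one_oedge (p : E → R) (hends : ends e = s(a₃, o)) (a₁ a₂ : V) :
    Qo (Function.update p e 1) ends o a₁ a₂ =
      prob (Function.update p e 0)
        (avoidAll ends a₂ {a₁} ∩ Nopp ends o a₁ a₂ a₃ ∩ (inU ends a₁ a₂ o ∪ inU ends a₁ a₂ a₃)) := by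
  unfold Qo
  have hdisj : Disjoint (avoidAll ends a₂ {a₁} ∩ connEvent ends a₁ o)
      (avoidAll ends a₂ {a₁} ∩ connEvent ends a₂ o) := by
    rw [Set.disjoint_left]
    rintro ω ⟨hQ, h1o⟩ ⟨_, h2o⟩
    simp only [mem_avoidAll, Finset.mem_singleton, forall_eq] at hQ
    exact hQ (conn_trans h2o (conn_symm h1o))
  rw [← prob_union_of_disjoint _ hdisj, prob_update_one_eq, prob_update_zero_eq]
  congr 1
  ext ω
  simp only [Set.mem_setOf_eq, Set.mem_union, Set.mem_inter_iff, mem_connEvent,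
    update_true_mem_Q_iff_oedge hends a₁ a₂ ω, conn_update_true_oedge_iff hends ω a₁ o,
    conn_update_true_oedge_iff hends ω a₂ o, mem_inU]
  have hr : Conn ends (Function.update ω e false) o o := conn_refl ends _ o
  constructor
  · rintro (⟨hQ, h | ⟨h13, _⟩ | ⟨h1o, _⟩⟩ | ⟨hQ, h | ⟨h23, _⟩ | ⟨h2o, _⟩⟩)
    · exact ⟨hQ, Or.inl (Or.inl (conn_symm h))⟩
    · exact ⟨hQ, Or.inr (Or.inl (conn_symm h13))⟩
    · exact ⟨hQ, Or.inl (Or.inl (conn_symm h1o))⟩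
    · exact ⟨hQ, Or.inl (Or.inr (conn_symm h))⟩
    · exact ⟨hQ, Or.inr (Or.inr (conn_symm h23))⟩
    · exact ⟨hQ, Or.inl (Or.inr (conn_symm h2o))⟩
  · rintro ⟨hQ, (ho1 | ho2) | (h31 | h32)⟩
    · exact Or.inl ⟨hQ, Or.inl (conn_symm ho1)⟩
    · exact Or.inr ⟨hQ, Or.inl (conn_symm ho2)⟩
    · exact Or.inl ⟨hQ, Or.inr (Or.inl ⟨conn_symm h31, hr⟩)⟩
    · exact Or.inr ⟨hQ, Or.inr (Or.inl ⟨conn_symm h32, hr⟩)⟩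

omit [Fintype V] [DecidableEq V] in
/-- **The quartic's cross term at an `o`-edge in the closed pin's masses**:
`covUm = Qo₁·D₀ + Qo₀·(D₀ − Do₀) − Q₁·Do₀`, with `Q₁ = P₀(Q ∩ Nopp)` and
`Qo₁ = P₀(Q ∩ Nopp ∩ ({o ∈ U} ∪ {a₃ ∈ U}))`. -/
theorem covUm_oedge_decomp (p : E → R) (hends : ends e = s(a₃, o)) (a₁ a₂ : V) :
    covUm p ends o a₁ a₂ a₃ e =
      prob (Function.update p e 0)
          (avoidAll ends a₂ {a₁} ∩ Nopp ends o a₁ a₂ a₃ ∩ (inU ends a₁ a₂ o ∪ inU ends a₁ a₂ a₃)) *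
          prob (Function.update p e 0) (PDEvent ends a₁ a₂ a₃) +
        Qo (Function.update p e 0) ends o a₁ a₂ *
          (prob (Function.update p e 0) (PDEvent ends a₁ a₂ a₃) -
            Do (Function.update p e 0) ends o a₁ a₂ a₃) -
        prob (Function.update p e 0) (avoidAll ends a₂ {a₁} ∩ Nopp ends o a₁ a₂ a₃) *
          Do (Function.update p e 0) ends o a₁ a₂ a₃ := by
  unfold covUm
  rw [Qo_one_oedge p hends a₁ a₂, prob_one_PD_oedge' p hends a₁ a₂, prob_one_Q_oedge p hends a₁ a₂,
    Do_one_oedge p hends a₁ a₂]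
  ring

end Glue

end QuarticOEdgeGlue

end Summit.Ventures.PercRepro2
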